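import Literature.AlgebraicGeometry.KTheory.GraysonRelativeKZeroRestrict
import Literature.AlgebraicGeometry.KTheory.HuInfinitesimalKZero
import HarnessLib

/-!
# X. Hu's kernel presentation via Grayson's presented relative `K₀`: the exact-sequence step
# discharged

`KTheory.HuKZeroKernelPresentation` (X. Hu, arXiv:2507.12458, Cor. 10.5(i) at `i = 0`, vendored in
`KTheory/HuInfinitesimalKZero`) asserts, for a smooth proper `𝒳/W(k)` of relative dimension `d` with
`d + 5 ≤ p` and its thickenings `X_l = 𝒳 ⊗ W/pˡ`, a family
`ρ m n : ⊕_{r=1}^{p−1} ℍ^{2r−1}(p^{r,m}_{r,n}Ω•) → K₀(X_n)` with (a) image = kernel of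
`K₀(X_n) → K₀(X_m)` (`1 ≤ m < n`) and (b) compatibility with the restrictions in `n`. In the source,
`ρ = (K₀(X_n, X_m) → K₀(X_n)) ∘ ch⁻¹` is assembled from TWO ingredients: Hu's relative Chern character
isomorphism `ch : K₀(X_n, X_m) ≅ ⊕ ℍ^{2r−1}` (Cor. 10.5(i)) and the EXACT SEQUENCE
`K₀(X_n, X_m) → K₀(X_n) → K₀(X_m)` of relative `K`-theory (used on p. 65).

With Grayson's presented relative group `K₀Ω[i^*]` of the restriction
`i^* : Vect(X_n) → Vect(X_m)` (`KTheory/GraysonRelativeKZero`, `RelKZero (thickeningMap 𝒳 h)`) the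
second ingredient is a THEOREM of the tree (`RelKZero.range_toKZero_eq_ker`, Grayson arXiv:1310.8644
Thm. 7 at `K₀𝓜`). This file records the resulting reduction:

* `huKZeroKernelPresentation_of_surjective` — **`HuKZeroKernelPresentation` follows from the existence
  of SURJECTIONS `σ m n : ⊕_{r=1}^{p−1} ℍ^{2r−1}(p^{r,m}_{r,n}Ω•) ↠ K₀Ω[i_{m,n}^*]` (`1 ≤ m < n`) compatible
  with the restrictions in `n`** (the presented-group form of the inverse relative Chern character of
  Cor. 10.5(i) and of Prop. 9.6(ii)): `ρ m n := toKZero ∘ σ m n`;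
* `huKZeroKernelPresentation_of_surjective_of_restrict` — the same with the compatibility stated
  INTRINSICALLY, as naturality of `σ` for Grayson's restriction
  `K₀Ω[i_{m,n'}^*] → K₀Ω[i_{m,n}^*]` (`KTheory/GraysonRelativeKZeroRestrict`, along
  `i_{m,n'} = i_{m,n} ≫ i_{n,n'}`, `thickeningMap_comp_thickeningMap`).

So, on the tree's carriers, what separates the named fact from a theorem is exactly Hu's isomorphism
for the presented relative group (whose identification with the Thomason–Trobaugh relative `K₀` is
Grayson's Conjecture 6). No named fact is introduced: the remaining input is an explicit hypothesis
of the reduction theorem, not a `def … : Prop` (D-0026).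

## References

* X. Hu, arXiv:2507.12458 (2025), Cor. 10.5(i), Prop. 9.6(ii), proof of Prop. 11.1 (p. 65).
  [Hu2025TruncatedWitt]
* D. R. Grayson, arXiv:1310.8644 (2013), Theorem 7, Lemma 19. [Grayson2013RelativeKTheory]
-/

noncomputable section

namespace Literature.AlgebraicGeometry.KTheory

open CategoryTheory _root_.AlgebraicGeometry
  Literature.AlgebraicGeometry.Motives Literature.AlgebraicGeometry.Motives.WittScheme

/-- **Hu's kernel presentation from a surjection onto Grayson's presented relative `K₀`.** Suppose that
for every `p, k, d, 𝒳` as in `HuKZeroKernelPresentation` there are homomorphisms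
`σ m n h : ⊕_{r=1}^{p−1} ℍ^{2r−1}(p^{r,m}_{r,n}Ω•) → K₀Ω[i_{m,n}^*]` (`i_{m,n} = thickeningMap 𝒳 h : X_m → X_n`)
which are SURJECTIVE for `1 ≤ m < n` and whose composites `ρ m n = toKZero ∘ σ m n` with Grayson's
`K₀Ω[i_{m,n}^*] → K₀(X_n)` are compatible with the restrictions `K₀(X_{n'}) → K₀(X_n)` and the reductions
of the sources (`n ≤ n'`). Then `HuKZeroKernelPresentation` holds, with `ρ m n := toKZero ∘ σ m n`:
clause (a) is the exactness `im(K₀Ω[i^*] → K₀(X_n)) = ker(K₀(X_n) → K₀(X_m))`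
(`RelKZero.range_toKZero_eq_ker`, Grayson Thm. 7 / Lemma 19) composed with the surjectivity of `σ`,
clause (b) is the assumed compatibility. (In the source `σ = ch⁻¹` for the Thomason–Trobaugh relative
`K₀`, Cor. 10.5(i), and (b) is Prop. 9.6(ii).)
[cite: Hu2025TruncatedWitt, Cor. 10.5(i) (p. 52), proof of Prop. 11.1 (p. 65)]
[cite: Grayson2013RelativeKTheory, Theorem 7] -/
theorem huKZeroKernelPresentation_of_surjective
    (H : ∀ (p : ℕ) [Fact p.Prime] (k : Type) [Field k] [CharP k p] [PerfectRing k p] (d : ℕ)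
      (𝒳 : SchemeOver (WittVector p k)), IsSmoothProperModel d 𝒳 → d + 5 ≤ p →
      ∃ σ : ∀ (m n : ℕ) (h : m ≤ n),
          HuKernelSource p k 𝒳 m n →+ RelKZero (thickeningMap 𝒳 h),
        (∀ (m n : ℕ) (hmn : m < n), 1 ≤ m → Function.Surjective (σ m n hmn.le)) ∧
        (∀ (m n n' : ℕ), 1 ≤ m → ∀ (hmn : m < n) (hnn' : n ≤ n') (x : HuKernelSource p k 𝒳 m n'),
          KZero.map (thickeningMap 𝒳 hnn')
              (RelKZero.toKZero (σ m n' (hmn.le.trans hnn') x)) =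
            RelKZero.toKZero (σ m n hmn.le (HuKernelSource.reduce m hnn' x)))) :
    HuKZeroKernelPresentation := by
  intro p _ k _ _ _ d 𝒳 h𝒳 hd
  obtain ⟨σ, hσ, hnat⟩ := H p k d 𝒳 h𝒳 hd
  classical
  -- `ρ m n := toKZero ∘ σ m n` for `m ≤ n` (and `0` otherwise, an irrelevant junk value)
  refine ⟨fun m n ↦ if h : m ≤ n then (RelKZero.toKZero).comp (σ m n h) else 0, ?_, ?_⟩
  · intro m n hmn hm η
    simp only [dif_pos hmn.le, AddMonoidHom.comp_apply]
    constructor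
    · intro hη
      have hmem : η ∈ (KZero.map (thickeningMap 𝒳 hmn.le)).ker := hη
      rw [← RelKZero.range_toKZero_eq_ker] at hmem
      obtain ⟨y, rfl⟩ := hmem
      obtain ⟨x, rfl⟩ := hσ m n hmn hm y
      exact ⟨x, rfl⟩
    · rintro ⟨x, rfl⟩
      exact RelKZero.map_toKZero _
  · intro m n n' hm hmn hnn' x
    simp only [dif_pos (hmn.le.trans hnn'), dif_pos hmn.le, AddMonoidHom.comp_apply]
    exact hnat m n n' hm hmn hnn' x

/-! ## Naturality via Grayson's restriction maps -/

/-- `X_m ⟶ X_n` lies over `Spec W_m ⟶ Spec W_n` (second projections of `X_l = 𝒳 ×_W Spec W_l`).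
[folklore] -/
private theorem thickeningMap_snd {p : ℕ} [Fact p.Prime] {k : Type} [CommRing k]
    (𝒳 : SchemeOver (WittVector p k)) {m n : ℕ} (h : m ≤ n) :
    thickeningMap 𝒳 h ≫ Limits.pullback.snd 𝒳.hom
        (Spec.map (CommRingCat.ofHom (algebraMap (WittVector p k) (wittQuot p k n)))) =
      Limits.pullback.snd 𝒳.hom
          (Spec.map (CommRingCat.ofHom (algebraMap (WittVector p k) (wittQuot p k m)))) ≫
        Spec.map (CommRingCat.ofHom (Ideal.Quotient.factor
          (Ideal.pow_le_pow_right (I := Ideal.span {(p : WittVector p k)}) h))) :=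
  Limits.pullback.lift_snd _ _ _

/-- `Spec W_a ⟶ Spec W_b ⟶ Spec W_c` is `Spec W_a ⟶ Spec W_c` (transitivity of the quotient maps
`W/p^c → W/p^b → W/p^a`, Mathlib `Ideal.Quotient.factor_comp`). [folklore] -/
private theorem specMap_factor_comp {p : ℕ} [Fact p.Prime] {k : Type} [CommRing k] {a b c : ℕ}
    (hab : a ≤ b) (hbc : b ≤ c) :
    Spec.map (CommRingCat.ofHom (Ideal.Quotient.factor
        (Ideal.pow_le_pow_right (I := Ideal.span {(p : WittVector p k)}) hab))) ≫
      Spec.map (CommRingCat.ofHom (Ideal.Quotient.factor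
        (Ideal.pow_le_pow_right (I := Ideal.span {(p : WittVector p k)}) hbc))) =
      Spec.map (CommRingCat.ofHom (Ideal.Quotient.factor
        (Ideal.pow_le_pow_right (I := Ideal.span {(p : WittVector p k)}) (hab.trans hbc)))) := by
  rw [← Spec.map_comp, ← CommRingCat.ofHom_comp, Ideal.Quotient.factor_comp]

/-- **Transitivity of the transition maps of the thickenings**: `(X_a → X_b) ≫ (X_b → X_c) = (X_a → X_c)`
(both are the base change of `𝒳` along `Spec W_a → Spec W_c`). [folklore] -/
theorem _root_.Literature.AlgebraicGeometry.Motives.WittScheme.thickeningMap_comp_thickeningMap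
    {p : ℕ} [Fact p.Prime] {k : Type} [CommRing k] (𝒳 : SchemeOver (WittVector p k)) {a b c : ℕ}
    (hab : a ≤ b) (hbc : b ≤ c) :
    thickeningMap 𝒳 hab ≫ thickeningMap 𝒳 hbc = thickeningMap 𝒳 (hab.trans hbc) := by
  apply Limits.pullback.hom_ext
  · exact (Category.assoc _ _ _).trans <|
      ((congrArg (thickeningMap 𝒳 hab ≫ ·) (thickeningMap_ι 𝒳 hbc)).trans
        (thickeningMap_ι 𝒳 hab)).trans (thickeningMap_ι 𝒳 (hab.trans hbc)).symm
  · exact (Category.assoc _ _ _).trans <|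
      ((congrArg (thickeningMap 𝒳 hab ≫ ·) (thickeningMap_snd 𝒳 hbc)).trans <|
        (Category.assoc _ _ _).symm.trans <|
        (congrArg (· ≫ Spec.map (CommRingCat.ofHom (Ideal.Quotient.factor
          (Ideal.pow_le_pow_right (I := Ideal.span {(p : WittVector p k)}) hbc))))
          (thickeningMap_snd 𝒳 hab)).trans <|
        (Category.assoc _ _ _).trans <|
        (congrArg (Limits.pullback.snd 𝒳.hom (Spec.map (CommRingCat.ofHom
          (algebraMap (WittVector p k) (wittQuot p k a)))) ≫ ·) (specMap_factor_comp hab hbc))).trans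
      (thickeningMap_snd 𝒳 (hab.trans hbc)).symm

/-- `toKZero` is insensitive to rewriting the morphism `f` along an equality (transport of
`K₀Ω[f^*]`). [folklore] -/
theorem RelKZero.toKZero_cast {Y X : Scheme} {f₁ f₂ : Y ⟶ X} (e : f₁ = f₂) (y : RelKZero f₁) :
    RelKZero.toKZero (e ▸ y : RelKZero f₂) = RelKZero.toKZero y := by
  subst e
  rfl

/-- **Hu's kernel presentation from a NATURAL surjection onto Grayson's presented relative `K₀`.**
As `huKZeroKernelPresentation_of_surjective`, with the compatibility in `n` stated intrinsically:
for `1 ≤ m < n ≤ n'`, Grayson's restriction `K₀Ω[i_{m,n'}^*] → K₀Ω[i_{m,n}^*]` along `X_n → X_{n'}`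
(`RelKZero.restrict`, after the identification `i_{m,n'} = i_{m,n} ≫ i_{n,n'}`) takes `σ m n' x` to
`σ m n (x reduced)`. The compatibility of `ρ = toKZero ∘ σ` with the restrictions of `K₀` then follows
from `RelKZero.toKZero_restrict` (the commuting square of Grayson's Theorem 7 for the map of pairs).
[cite: Hu2025TruncatedWitt, Cor. 10.5(i) (p. 52), Prop. 9.6(ii) (p. 47)]
[cite: Grayson2013RelativeKTheory, Theorem 7] -/
theorem huKZeroKernelPresentation_of_surjective_of_restrict
    (H : ∀ (p : ℕ) [Fact p.Prime] (k : Type) [Field k] [CharP k p] [PerfectRing k p] (d : ℕ)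
      (𝒳 : SchemeOver (WittVector p k)), IsSmoothProperModel d 𝒳 → d + 5 ≤ p →
      ∃ σ : ∀ (m n : ℕ) (h : m ≤ n),
          HuKernelSource p k 𝒳 m n →+ RelKZero (thickeningMap 𝒳 h),
        (∀ (m n : ℕ) (hmn : m < n), 1 ≤ m → Function.Surjective (σ m n hmn.le)) ∧
        (∀ (m n n' : ℕ), 1 ≤ m → ∀ (hmn : m < n) (hnn' : n ≤ n') (x : HuKernelSource p k 𝒳 m n'),
          RelKZero.restrict (thickeningMap 𝒳 hmn.le) (thickeningMap 𝒳 hnn')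
              ((thickeningMap_comp_thickeningMap 𝒳 hmn.le hnn').symm ▸
                σ m n' (hmn.le.trans hnn') x) =
            σ m n hmn.le (HuKernelSource.reduce m hnn' x))) :
    HuKZeroKernelPresentation :=
  huKZeroKernelPresentation_of_surjective fun p _ k _ _ _ d 𝒳 h𝒳 hd ↦ by
    obtain ⟨σ, hσ, hnat⟩ := H p k d 𝒳 h𝒳 hd
    refine ⟨σ, hσ, fun m n n' hm hmn hnn' x ↦ ?_⟩
    rw [← hnat m n n' hm hmn hnn' x, RelKZero.toKZero_restrict, RelKZero.toKZero_cast]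

end Literature.AlgebraicGeometry.KTheory

end
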